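/-
Origin: written from primary sources — A. Weil, Acta Math. 111 (1964) Chap. III n° 37–38 pp. 188–190 (the
metaplectic representation of an orthogonal direct sum), n° 41 Thm 6 p. 193 (invariance of `Θ` under rational
points); R. Howe, *θ-series and invariant theory* (1979) §2–§3 (see-saw restriction up to a character); S. Kudla,
*Seesaw dual reductive pairs* (1984) §1; S. Gelbart, J. Rogawski, Invent. Math. 105 (1991) §3.1 Remark p. 457.
Adapted: no. This file is the JUNCTION of the two-factor Schur lemma for the adelic metaplectic operators
(`AdelicMetaplecticTensorSchur.exists_ne_zero_smul_tensorToSum_of_fst_eq_spSum`) with the group-level bookkeeping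
(`AdelicSchwartzBruhatTensorCharacter`): along three homomorphisms into the continuous metaplectic groups of
`W₁`, `W₂`, `W₁ ⊕ W₂` lying over the see-saw embedding, the scalars form a continuous character, trivial at every
element landing in the `Θ`-fixing pairs, and the renormalised representations restrict on the nose. Kernel only.
-/
import Literature.NumberTheory.Weil1964.AdelicMetaplecticTensorSchur
import Literature.NumberTheory.Automorphic.AdelicSchwartzBruhatTensorCharacter
import HarnessLib

/-!
# The see-saw character of three compatible homomorphisms into `Mp_ψ(W₁)ᶜᵒⁿᵗ, Mp_ψ(W₂)ᶜᵒⁿᵗ, Mp_ψ(W₁ ⊕ W₂)ᶜᵒⁿᵗ`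

Setting: a number field `F`, invertible Gram matrices `T_j ∈ GL_{ι_j}(𝔸_F)`, `T = fromBlocks T₁ 0 0 T₂`, a group `P`
(model case: the adelic points of the see-saw sub-pair `U(V) × (U(W₁) × U(W₂))`, or any group mapping to it) and
three homomorphisms

  `s : P →* adelicMpCont F (ι₁ ⊕ ι₂) T`, `s₁ : P →* adelicMpCont F ι₁ T₁`, `s₂ : P →* adelicMpCont F ι₂ T₂`

LYING OVER THE SEE-SAW EMBEDDING: `π (s p) = π (s₁ p) ⊕ π (s₂ p)` (`UnitaryGroup.spSum`).  (Model case: the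
GR91-compatible splittings of the three dual pairs composed with the see-saw inclusions; the hypothesis is the
group-side compatibility of [Kudla1984, §1].)

* `exists_seesaw_scalar` — for every `p`, ONE scalar `c ≠ 0` with
  `ω(s p) (Φ₁ ⊠ Φ₂) = c • (ω(s₁ p) Φ₁ ⊠ ω(s₂ p) Φ₂)` (the two-factor Schur lemma of
  `AdelicMetaplecticTensorSchur`, instantiated);
* **`mpSeesawChar s s₁ s₂ hs hT₁ hT₂ : P →* ℂˣ`** — the scalars form a character (`seesawChar` of
  `AdelicSchwartzBruhatTensorCharacter`), `mpSeesawChar_spec`;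
* **`mpSeesawChar_eq_one_of_mem_adelicMpTheta`** — `χ p = 1` whenever `s p`, `s₁ p`, `s₂ p` are `Θ`-fixing pairs
  (model case: `p` rational and the three splittings compatible in the sense of [GelbartRogawski1991] Prop. 3.1.1,
  i.e. rational points land in Weil's `r_F(Sp_F)`, whose operators fix `Θ` [Weil1964, Thm 6]);
* **`continuous_mpSeesawChar`** — `χ` is continuous when `s, s₁, s₂` are (coefficient topology of `Mp_ψ(W_𝔸)`);
* `twist_inv_mpSeesawChar_apply_tensorToSum` — scheme (M) on the nose: the `χ⁻¹`-twisted big representation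
  restricts to `ω ∘ s₁ ⊠ ω ∘ s₂` exactly; and for `P = GV × (U₁ × U₂)` with `s_j` defined on `GV × U_j`
  (`exists_seesaw_scalar₃`, `mpSeesawChar₃`, `mpCharV/mpChar₁/mpChar₂/mpCharSmall₁/mpCharSmall₂`,
  `mpSeesaw_tensorToSum_twist_small` / `_big`, `mpCharV/mpChar₁/mpChar₂_eq_one_of_mem_adelicMpTheta`,
  `continuous_mpCharV/…`): the scheme identities in the shape of the package's `RestrictTmul`.

Nothing here chooses a scheme or says anything about archimedean components; see the closing paragraph of
`RepresentationTheory/SeesawScalarCharacter`.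
-/

set_option autoImplicit false

noncomputable section

open scoped Matrix Classical

open NumberField IsDedekindDomain
open Literature.RepresentationTheory Literature.RepresentationTheory.SeesawScalar Literature.NumberTheory.Automorphic

namespace Literature.NumberTheory.Weil1964

variable {F : Type} [Field F] [NumberField F]
variable {ι₁ ι₂ : Type} [Fintype ι₁] [DecidableEq ι₁] [Fintype ι₂] [DecidableEq ι₂]
variable {T₁ : Matrix ι₁ ι₁ (AdeleRing (𝓞 F) F)} {T₂ : Matrix ι₂ ι₂ (AdeleRing (𝓞 F) F)}

section General

variable {P : Type*} [Group P]
  (s : P →* adelicMpCont F (ι₁ ⊕ ι₂) (Matrix.fromBlocks T₁ 0 0 T₂))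
  (s₁ : P →* adelicMpCont F ι₁ T₁) (s₂ : P →* adelicMpCont F ι₂ T₂)
  (hs : ∀ p : P, adelicMpCont.proj F (ι₁ ⊕ ι₂) (Matrix.fromBlocks T₁ 0 0 T₂) (s p) =
    UnitaryGroup.spSum T₁ T₂ (adelicMpCont.proj F ι₁ T₁ (s₁ p), adelicMpCont.proj F ι₂ T₂ (s₂ p)))
  (hT₁ : IsUnit T₁) (hT₂ : IsUnit T₂)

include hs hT₁ hT₂ in
/-- **The per-element two-factor Schur statement along `(s, s₁, s₂)`**: for every `p ∈ P` there is ONE scalar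
`c ≠ 0` with `ω(s p) (Φ₁ ⊠ Φ₂) = c • (ω(s₁ p) Φ₁ ⊠ ω(s₂ p) Φ₂)`.
[cite: Weil1964, Chap. III n° 37–38 pp. 188–190] -/
theorem exists_seesaw_scalar (p : P) :
    ∃ c : ℂ, c ≠ 0 ∧ ∀ (Φ₁ : piSchwartzBruhat F ι₁) (Φ₂ : piSchwartzBruhat F ι₂),
      (adelicMpCont.omega F (ι₁ ⊕ ι₂) (Matrix.fromBlocks T₁ 0 0 T₂)).comp s p (tensorToSum F ι₁ ι₂ Φ₁ Φ₂) =
        c • tensorToSum F ι₁ ι₂ ((adelicMpCont.omega F ι₁ T₁).comp s₁ p Φ₁)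
          ((adelicMpCont.omega F ι₂ T₂).comp s₂ p Φ₂) :=
  exists_ne_zero_smul_tensorToSum_of_fst_eq_spSum hT₁ hT₂ (s₁ p) (s₁ p).2 (s₂ p) (s₂ p).2 (s p) (s p).2 (hs p)

/-- **The see-saw character of `(s, s₁, s₂)`**: `P →* ℂˣ`. (cf. R. Howe (1979) §3; S. Kudla (1984) §1) [folklore] -/
def mpSeesawChar : P →* ℂˣ :=
  seesawChar ((adelicMpCont.omega F (ι₁ ⊕ ι₂) (Matrix.fromBlocks T₁ 0 0 T₂)).comp s)
    ((adelicMpCont.omega F ι₁ T₁).comp s₁) ((adelicMpCont.omega F ι₂ T₂).comp s₂)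
    (exists_seesaw_scalar s s₁ s₂ hs hT₁ hT₂)

/-- The defining identity `ω(s p) (Φ₁ ⊠ Φ₂) = χ(p) • (ω(s₁ p) Φ₁ ⊠ ω(s₂ p) Φ₂)`. [folklore] -/
theorem mpSeesawChar_spec (p : P) (Φ₁ : piSchwartzBruhat F ι₁) (Φ₂ : piSchwartzBruhat F ι₂) :
    adelicMpCont.omega F (ι₁ ⊕ ι₂) (Matrix.fromBlocks T₁ 0 0 T₂) (s p) (tensorToSum F ι₁ ι₂ Φ₁ Φ₂) =
      (mpSeesawChar s s₁ s₂ hs hT₁ hT₂ p : ℂ) •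
        tensorToSum F ι₁ ι₂ (adelicMpCont.omega F ι₁ T₁ (s₁ p) Φ₁) (adelicMpCont.omega F ι₂ T₂ (s₂ p) Φ₂) :=
  seesawChar_spec _ _ _ (exists_seesaw_scalar s s₁ s₂ hs hT₁ hT₂) p Φ₁ Φ₂

/-- Uniqueness: any scalar that works at `p` is `χ(p)`. [folklore] -/
theorem coe_mpSeesawChar_eq {p : P} {c : ℂ}
    (hc : ∀ (Φ₁ : piSchwartzBruhat F ι₁) (Φ₂ : piSchwartzBruhat F ι₂),
      adelicMpCont.omega F (ι₁ ⊕ ι₂) (Matrix.fromBlocks T₁ 0 0 T₂) (s p) (tensorToSum F ι₁ ι₂ Φ₁ Φ₂) =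
        c • tensorToSum F ι₁ ι₂ (adelicMpCont.omega F ι₁ T₁ (s₁ p) Φ₁) (adelicMpCont.omega F ι₂ T₂ (s₂ p) Φ₂)) :
    (mpSeesawChar s s₁ s₂ hs hT₁ hT₂ p : ℂ) = c :=
  coe_seesawChar_eq _ _ _ (exists_seesaw_scalar s s₁ s₂ hs hT₁ hT₂) hc

/-- A `Θ`-fixing pair preserves the theta distribution `thetaDistLM` (membership unfolded). [cite: Weil1964, Chap. III
n° 41 Thm 6 p. 193] -/
theorem thetaDistLM_omega_of_mem_adelicMpTheta {ι : Type} [Fintype ι] [DecidableEq ι]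
    {T : Matrix ι ι (AdeleRing (𝓞 F) F)} {q : adelicMpCont F ι T}
    (hq : (q : adelicMp F ι T) ∈ adelicMpTheta F ι T) (Φ : piSchwartzBruhat F ι) :
    thetaDistLM F ι (adelicMpCont.omega F ι T q Φ) = thetaDistLM F ι Φ :=
  (MpPsi.mem_fixing_iff _ _ _).mp hq Φ

/-- **`χ(p) = 1` when `s p`, `s₁ p`, `s₂ p` are `Θ`-fixing pairs** (model case: `p` a rational point of the
sub-pair and the three splittings compatible — rational points land in Weil's `r_F(Sp_F)`, whose operators fix `Θ`).
[cite: Weil1964, Chap. III n° 41 Thm 6 p. 193] -/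
theorem mpSeesawChar_eq_one_of_mem_adelicMpTheta {p : P}
    (hp : (s p : adelicMp F (ι₁ ⊕ ι₂) (Matrix.fromBlocks T₁ 0 0 T₂)) ∈
      adelicMpTheta F (ι₁ ⊕ ι₂) (Matrix.fromBlocks T₁ 0 0 T₂))
    (hp₁ : (s₁ p : adelicMp F ι₁ T₁) ∈ adelicMpTheta F ι₁ T₁)
    (hp₂ : (s₂ p : adelicMp F ι₂ T₂) ∈ adelicMpTheta F ι₂ T₂) :
    mpSeesawChar s s₁ s₂ hs hT₁ hT₂ p = 1 :=
  seesawChar_eq_one_of_thetaDistLM _ _ _ (exists_seesaw_scalar s s₁ s₂ hs hT₁ hT₂)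
    (fun Φ => thetaDistLM_omega_of_mem_adelicMpTheta hp Φ)
    (fun Φ => thetaDistLM_omega_of_mem_adelicMpTheta hp₁ Φ)
    (fun Φ => thetaDistLM_omega_of_mem_adelicMpTheta hp₂ Φ)

/-- **Scheme (M) on the nose**: the `χ⁻¹`-twisted representation `p ↦ χ(p)⁻¹ ω(s p)` restricts to
`ω ∘ s₁ ⊠ ω ∘ s₂` exactly. [folklore] -/
theorem twist_inv_mpSeesawChar_apply_tensorToSum (p : P) (Φ₁ : piSchwartzBruhat F ι₁)
    (Φ₂ : piSchwartzBruhat F ι₂) :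
    SeesawScalar.twist (mpSeesawChar s s₁ s₂ hs hT₁ hT₂)⁻¹
        ((adelicMpCont.omega F (ι₁ ⊕ ι₂) (Matrix.fromBlocks T₁ 0 0 T₂)).comp s) p (tensorToSum F ι₁ ι₂ Φ₁ Φ₂) =
      tensorToSum F ι₁ ι₂ (adelicMpCont.omega F ι₁ T₁ (s₁ p) Φ₁) (adelicMpCont.omega F ι₂ T₂ (s₂ p) Φ₂) :=
  twist_inv_seesawChar_apply_tensorToSum _ _ _ (exists_seesaw_scalar s s₁ s₂ hs hT₁ hT₂) p Φ₁ Φ₂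

/-- At an element whose three images are `Θ`-fixing the twisted big representation agrees with `ω(s p)`.
[folklore] -/
theorem twist_inv_mpSeesawChar_eq_of_mem_adelicMpTheta {p : P}
    (hp : (s p : adelicMp F (ι₁ ⊕ ι₂) (Matrix.fromBlocks T₁ 0 0 T₂)) ∈
      adelicMpTheta F (ι₁ ⊕ ι₂) (Matrix.fromBlocks T₁ 0 0 T₂))
    (hp₁ : (s₁ p : adelicMp F ι₁ T₁) ∈ adelicMpTheta F ι₁ T₁)
    (hp₂ : (s₂ p : adelicMp F ι₂ T₂) ∈ adelicMpTheta F ι₂ T₂) :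
    SeesawScalar.twist (mpSeesawChar s s₁ s₂ hs hT₁ hT₂)⁻¹
        ((adelicMpCont.omega F (ι₁ ⊕ ι₂) (Matrix.fromBlocks T₁ 0 0 T₂)).comp s) p =
      adelicMpCont.omega F (ι₁ ⊕ ι₂) (Matrix.fromBlocks T₁ 0 0 T₂) (s p) :=
  twist_apply_of_eq_one _ (by
    rw [MonoidHom.inv_apply, mpSeesawChar_eq_one_of_mem_adelicMpTheta s s₁ s₂ hs hT₁ hT₂ hp hp₁ hp₂, inv_one])

/-- **Continuity of the see-saw character** along continuous `s, s₁, s₂` (for the coefficient topology of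
`Mp_ψ(W_𝔸)`: `adelicMpCont.continuous_omega_apply`). [folklore] -/
theorem continuous_mpSeesawChar [TopologicalSpace P] (hc : Continuous s) (hc₁ : Continuous s₁)
    (hc₂ : Continuous s₂) : Continuous fun p : P => (mpSeesawChar s s₁ s₂ hs hT₁ hT₂ p : ℂ) :=
  continuous_seesawChar _ _ _ (exists_seesaw_scalar s s₁ s₂ hs hT₁ hT₂)
    (fun Ψ x => (adelicMpCont.continuous_omega_apply Ψ x).comp hc)
    (fun Φ x => (adelicMpCont.continuous_omega_apply Φ x).comp hc₁)
    (fun Φ x => (adelicMpCont.continuous_omega_apply Φ x).comp hc₂)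

end General

/-! ## The see-saw product group `GV × (U₁ × U₂)` -/

section Product

variable {GV U₁ U₂ : Type*} [Group GV] [Group U₁] [Group U₂]
  (s : GV × (U₁ × U₂) →* adelicMpCont F (ι₁ ⊕ ι₂) (Matrix.fromBlocks T₁ 0 0 T₂))
  (s₁ : GV × U₁ →* adelicMpCont F ι₁ T₁) (s₂ : GV × U₂ →* adelicMpCont F ι₂ T₂)
  (hs : ∀ (g : GV) (u₁ : U₁) (u₂ : U₂),
    adelicMpCont.proj F (ι₁ ⊕ ι₂) (Matrix.fromBlocks T₁ 0 0 T₂) (s (g, (u₁, u₂))) =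
      UnitaryGroup.spSum T₁ T₂
        (adelicMpCont.proj F ι₁ T₁ (s₁ (g, u₁)), adelicMpCont.proj F ι₂ T₂ (s₂ (g, u₂))))
  (hT₁ : IsUnit T₁) (hT₂ : IsUnit T₂)

include hs hT₁ hT₂ in
/-- The per-element two-factor Schur statement in see-saw form: for every `(g,(u₁,u₂))` ONE scalar `c ≠ 0` with
`ω(s (g,(u₁,u₂))) (Φ₁ ⊠ Φ₂) = c • (ω(s₁ (g,u₁)) Φ₁ ⊠ ω(s₂ (g,u₂)) Φ₂)` — the hypothesis `h` of
`AdelicSchwartzBruhatTensorCharacter`'s see-saw section. [cite: Weil1964, Chap. III n° 37–38 pp. 188–190] -/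
theorem exists_seesaw_scalar₃ (p : GV × (U₁ × U₂)) :
    ∃ c : ℂ, c ≠ 0 ∧ ∀ (Φ₁ : piSchwartzBruhat F ι₁) (Φ₂ : piSchwartzBruhat F ι₂),
      (adelicMpCont.omega F (ι₁ ⊕ ι₂) (Matrix.fromBlocks T₁ 0 0 T₂)).comp s p (tensorToSum F ι₁ ι₂ Φ₁ Φ₂) =
        c • tensorToSum F ι₁ ι₂
          ((adelicMpCont.omega F ι₁ T₁).comp s₁ (seesawFst GV U₁ U₂ p) Φ₁)
          ((adelicMpCont.omega F ι₂ T₂).comp s₂ (seesawSnd GV U₁ U₂ p) Φ₂) := by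
  obtain ⟨g, u₁, u₂⟩ := p
  exact exists_ne_zero_smul_tensorToSum_of_fst_eq_spSum hT₁ hT₂ (s₁ (g, u₁)) (s₁ (g, u₁)).2 (s₂ (g, u₂))
    (s₂ (g, u₂)).2 (s (g, (u₁, u₂))) (s (g, (u₁, u₂))).2 (hs g u₁ u₂)

/-- **The see-saw character on `GV × (U₁ × U₂)`** of the three splittings (`seesawChar₃` of
`AdelicSchwartzBruhatTensorCharacter`). [folklore] -/
def mpSeesawChar₃ : GV × (U₁ × U₂) →* ℂˣ :=
  seesawChar₃ ((adelicMpCont.omega F (ι₁ ⊕ ι₂) (Matrix.fromBlocks T₁ 0 0 T₂)).comp s)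
    ((adelicMpCont.omega F ι₁ T₁).comp s₁) ((adelicMpCont.omega F ι₂ T₂).comp s₂)
    (exists_seesaw_scalar₃ s s₁ s₂ hs hT₁ hT₂)

/-- `λV : GV →* ℂˣ`, `g ↦ χ(g,(1,1))` (`charV`). [folklore] -/
def mpCharV : GV →* ℂˣ :=
  charV (tensorToSum F ι₁ ι₂) ((adelicMpCont.omega F (ι₁ ⊕ ι₂) (Matrix.fromBlocks T₁ 0 0 T₂)).comp s)
    ((adelicMpCont.omega F ι₁ T₁).comp s₁) ((adelicMpCont.omega F ι₂ T₂).comp s₂)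
    (exists_seesaw_scalar₃ s s₁ s₂ hs hT₁ hT₂) exists_tensorToSum_ne_zero'

/-- `λ₁ : U₁ →* ℂˣ`, `u₁ ↦ χ(1,(u₁,1))` (`char₁`). [folklore] -/
def mpChar₁ : U₁ →* ℂˣ :=
  char₁ (tensorToSum F ι₁ ι₂) ((adelicMpCont.omega F (ι₁ ⊕ ι₂) (Matrix.fromBlocks T₁ 0 0 T₂)).comp s)
    ((adelicMpCont.omega F ι₁ T₁).comp s₁) ((adelicMpCont.omega F ι₂ T₂).comp s₂)
    (exists_seesaw_scalar₃ s s₁ s₂ hs hT₁ hT₂) exists_tensorToSum_ne_zero'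

/-- `λ₂ : U₂ →* ℂˣ`, `u₂ ↦ χ(1,(1,u₂))` (`char₂`). [folklore] -/
def mpChar₂ : U₂ →* ℂˣ :=
  char₂ (tensorToSum F ι₁ ι₂) ((adelicMpCont.omega F (ι₁ ⊕ ι₂) (Matrix.fromBlocks T₁ 0 0 T₂)).comp s)
    ((adelicMpCont.omega F ι₁ T₁).comp s₁) ((adelicMpCont.omega F ι₂ T₂).comp s₂)
    (exists_seesaw_scalar₃ s s₁ s₂ hs hT₁ hT₂) exists_tensorToSum_ne_zero'

/-- The character of the first small pair under scheme (small): `(g,u₁) ↦ λV g · λ₁ u₁` (`charSmall₁`). [folklore] -/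
def mpCharSmall₁ : GV × U₁ →* ℂˣ :=
  charSmall₁ (tensorToSum F ι₁ ι₂) ((adelicMpCont.omega F (ι₁ ⊕ ι₂) (Matrix.fromBlocks T₁ 0 0 T₂)).comp s)
    ((adelicMpCont.omega F ι₁ T₁).comp s₁) ((adelicMpCont.omega F ι₂ T₂).comp s₂)
    (exists_seesaw_scalar₃ s s₁ s₂ hs hT₁ hT₂) exists_tensorToSum_ne_zero'

/-- The character of the second small pair under scheme (small): `(g,u₂) ↦ λ₂ u₂` (`charSmall₂`). [folklore] -/
def mpCharSmall₂ : GV × U₂ →* ℂˣ :=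
  charSmall₂ (tensorToSum F ι₁ ι₂) ((adelicMpCont.omega F (ι₁ ⊕ ι₂) (Matrix.fromBlocks T₁ 0 0 T₂)).comp s)
    ((adelicMpCont.omega F ι₁ T₁).comp s₁) ((adelicMpCont.omega F ι₂ T₂).comp s₂)
    (exists_seesaw_scalar₃ s s₁ s₂ hs hT₁ hT₂) exists_tensorToSum_ne_zero'

/-- The defining identity in see-saw form:
`ω(s (g,(u₁,u₂))) (Φ₁ ⊠ Φ₂) = χ(g,(u₁,u₂)) • (ω(s₁ (g,u₁)) Φ₁ ⊠ ω(s₂ (g,u₂)) Φ₂)`. [folklore] -/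
theorem mpSeesawChar₃_spec (g : GV) (u₁ : U₁) (u₂ : U₂) (Φ₁ : piSchwartzBruhat F ι₁)
    (Φ₂ : piSchwartzBruhat F ι₂) :
    adelicMpCont.omega F (ι₁ ⊕ ι₂) (Matrix.fromBlocks T₁ 0 0 T₂) (s (g, (u₁, u₂))) (tensorToSum F ι₁ ι₂ Φ₁ Φ₂) =
      (mpSeesawChar₃ s s₁ s₂ hs hT₁ hT₂ (g, (u₁, u₂)) : ℂ) •
        tensorToSum F ι₁ ι₂ (adelicMpCont.omega F ι₁ T₁ (s₁ (g, u₁)) Φ₁)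
          (adelicMpCont.omega F ι₂ T₂ (s₂ (g, u₂)) Φ₂) :=
  seesawScalarChar_spec _ _ _ _ (exists_seesaw_scalar₃ s s₁ s₂ hs hT₁ hT₂) exists_tensorToSum_ne_zero' g u₁ u₂ Φ₁ Φ₂

/-- `χ(g,(u₁,u₂)) = λV g · λ₁ u₁ · λ₂ u₂`. [folklore] -/
theorem mpSeesawChar₃_factor (g : GV) (u₁ : U₁) (u₂ : U₂) :
    mpSeesawChar₃ s s₁ s₂ hs hT₁ hT₂ (g, (u₁, u₂)) =
      mpCharV s s₁ s₂ hs hT₁ hT₂ g * mpChar₁ s s₁ s₂ hs hT₁ hT₂ u₁ * mpChar₂ s s₁ s₂ hs hT₁ hT₂ u₂ :=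
  seesawScalarChar_factor _ _ _ _ (exists_seesaw_scalar₃ s s₁ s₂ hs hT₁ hT₂) exists_tensorToSum_ne_zero' g u₁ u₂

/-- `charSmall₁ (g,u₁) = λV g · λ₁ u₁`. [folklore] -/
theorem mpCharSmall₁_apply_eq_mul (g : GV) (u₁ : U₁) :
    mpCharSmall₁ s s₁ s₂ hs hT₁ hT₂ (g, u₁) = mpCharV s s₁ s₂ hs hT₁ hT₂ g * mpChar₁ s s₁ s₂ hs hT₁ hT₂ u₁ :=
  charSmall₁_apply_eq_mul _ _ _ _ (exists_seesaw_scalar₃ s s₁ s₂ hs hT₁ hT₂) exists_tensorToSum_ne_zero' g u₁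

/-- `charSmall₂ (g,u₂) = λ₂ u₂`. [folklore] -/
theorem mpCharSmall₂_apply (g : GV) (u₂ : U₂) :
    mpCharSmall₂ s s₁ s₂ hs hT₁ hT₂ (g, u₂) = mpChar₂ s s₁ s₂ hs hT₁ hT₂ u₂ :=
  rfl

/-- **Scheme (small) on the nose, in the shape of the package's `RestrictTmul`**: keep `ω ∘ s`; twist `ω ∘ s₁` by
`(g,u₁) ↦ λV g · λ₁ u₁` and `ω ∘ s₂` by `(g,u₂) ↦ λ₂ u₂`; then for ALL `g, u₁, u₂, Φ₁, Φ₂`: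
`ω(s (g,(u₁,u₂))) (Φ₁ ⊠ Φ₂) = ω₁′ (g,u₁) Φ₁ ⊠ ω₂′ (g,u₂) Φ₂`. [folklore] -/
theorem mpSeesaw_tensorToSum_twist_small (g : GV) (u₁ : U₁) (u₂ : U₂) (Φ₁ : piSchwartzBruhat F ι₁)
    (Φ₂ : piSchwartzBruhat F ι₂) :
    adelicMpCont.omega F (ι₁ ⊕ ι₂) (Matrix.fromBlocks T₁ 0 0 T₂) (s (g, (u₁, u₂))) (tensorToSum F ι₁ ι₂ Φ₁ Φ₂) =
      tensorToSum F ι₁ ι₂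
        (SeesawScalar.twist (mpCharSmall₁ s s₁ s₂ hs hT₁ hT₂) ((adelicMpCont.omega F ι₁ T₁).comp s₁) (g, u₁) Φ₁)
        (SeesawScalar.twist (mpCharSmall₂ s s₁ s₂ hs hT₁ hT₂) ((adelicMpCont.omega F ι₂ T₂).comp s₂) (g, u₂) Φ₂) :=
  seesaw_tensorToSum_twist_small _ _ _ (exists_seesaw_scalar₃ s s₁ s₂ hs hT₁ hT₂) g u₁ u₂ Φ₁ Φ₂

/-- **Scheme (big) on the nose** («`s_V^W ↦ s_V^W · λV⁻¹`, `s_{W_j} ↦ s_{W_j} · λ_j`»): twist `ω ∘ s` by `λV⁻¹` on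
`GV`, `ω ∘ s₁` by `λ₁` on `U₁`, `ω ∘ s₂` by `λ₂` on `U₂`. [folklore] -/
theorem mpSeesaw_tensorToSum_twist_big (g : GV) (u₁ : U₁) (u₂ : U₂) (Φ₁ : piSchwartzBruhat F ι₁)
    (Φ₂ : piSchwartzBruhat F ι₂) :
    SeesawScalar.twist
        (charBigV (tensorToSum F ι₁ ι₂) ((adelicMpCont.omega F (ι₁ ⊕ ι₂) (Matrix.fromBlocks T₁ 0 0 T₂)).comp s)
          ((adelicMpCont.omega F ι₁ T₁).comp s₁) ((adelicMpCont.omega F ι₂ T₂).comp s₂)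
          (exists_seesaw_scalar₃ s s₁ s₂ hs hT₁ hT₂) exists_tensorToSum_ne_zero')⁻¹
        ((adelicMpCont.omega F (ι₁ ⊕ ι₂) (Matrix.fromBlocks T₁ 0 0 T₂)).comp s) (g, (u₁, u₂))
        (tensorToSum F ι₁ ι₂ Φ₁ Φ₂) =
      tensorToSum F ι₁ ι₂
        (SeesawScalar.twist
          (charBig₁ (tensorToSum F ι₁ ι₂) ((adelicMpCont.omega F (ι₁ ⊕ ι₂) (Matrix.fromBlocks T₁ 0 0 T₂)).comp s)
            ((adelicMpCont.omega F ι₁ T₁).comp s₁) ((adelicMpCont.omega F ι₂ T₂).comp s₂)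
            (exists_seesaw_scalar₃ s s₁ s₂ hs hT₁ hT₂) exists_tensorToSum_ne_zero')
          ((adelicMpCont.omega F ι₁ T₁).comp s₁) (g, u₁) Φ₁)
        (SeesawScalar.twist (mpCharSmall₂ s s₁ s₂ hs hT₁ hT₂) ((adelicMpCont.omega F ι₂ T₂).comp s₂) (g, u₂) Φ₂) :=
  seesaw_tensorToSum_twist_big _ _ _ (exists_seesaw_scalar₃ s s₁ s₂ hs hT₁ hT₂) g u₁ u₂ Φ₁ Φ₂

/-- **`λV γ = 1`** when `s (γ,(1,1))`, `s₁ (γ,1)`, `s₂ (γ,1)` are `Θ`-fixing pairs (model case: `γ ∈ U(V)(F)` and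
the three splittings compatible). [cite: Weil1964, Chap. III n° 41 Thm 6 p. 193] -/
theorem mpCharV_eq_one_of_mem_adelicMpTheta {γ : GV}
    (hp : (s (γ, (1, 1)) : adelicMp F (ι₁ ⊕ ι₂) (Matrix.fromBlocks T₁ 0 0 T₂)) ∈
      adelicMpTheta F (ι₁ ⊕ ι₂) (Matrix.fromBlocks T₁ 0 0 T₂))
    (hp₁ : (s₁ (γ, 1) : adelicMp F ι₁ T₁) ∈ adelicMpTheta F ι₁ T₁)
    (hp₂ : (s₂ (γ, 1) : adelicMp F ι₂ T₂) ∈ adelicMpTheta F ι₂ T₂) :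
    mpCharV s s₁ s₂ hs hT₁ hT₂ γ = 1 :=
  charV_eq_one_of_thetaDistLM _ _ _ (exists_seesaw_scalar₃ s s₁ s₂ hs hT₁ hT₂)
    (fun Φ => thetaDistLM_omega_of_mem_adelicMpTheta hp Φ)
    (fun Φ => thetaDistLM_omega_of_mem_adelicMpTheta hp₁ Φ)
    (fun Φ => thetaDistLM_omega_of_mem_adelicMpTheta hp₂ Φ)

/-- **`λ₁ δ = 1`** when `s (1,(δ,1))`, `s₁ (1,δ)` are `Θ`-fixing pairs (model case: `δ ∈ U(W₁)(F)`).
[cite: Weil1964, Chap. III n° 41 Thm 6 p. 193] -/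
theorem mpChar₁_eq_one_of_mem_adelicMpTheta {δ : U₁}
    (hp : (s (1, (δ, 1)) : adelicMp F (ι₁ ⊕ ι₂) (Matrix.fromBlocks T₁ 0 0 T₂)) ∈
      adelicMpTheta F (ι₁ ⊕ ι₂) (Matrix.fromBlocks T₁ 0 0 T₂))
    (hp₁ : (s₁ (1, δ) : adelicMp F ι₁ T₁) ∈ adelicMpTheta F ι₁ T₁) :
    mpChar₁ s s₁ s₂ hs hT₁ hT₂ δ = 1 :=
  char₁_eq_one_of_thetaDistLM _ _ _ (exists_seesaw_scalar₃ s s₁ s₂ hs hT₁ hT₂)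
    (fun Φ => thetaDistLM_omega_of_mem_adelicMpTheta hp Φ)
    (fun Φ => thetaDistLM_omega_of_mem_adelicMpTheta hp₁ Φ)

/-- **`λ₂ δ = 1`** when `s (1,(1,δ))`, `s₂ (1,δ)` are `Θ`-fixing pairs (model case: `δ ∈ U(W₂)(F)`).
[cite: Weil1964, Chap. III n° 41 Thm 6 p. 193] -/
theorem mpChar₂_eq_one_of_mem_adelicMpTheta {δ : U₂}
    (hp : (s (1, (1, δ)) : adelicMp F (ι₁ ⊕ ι₂) (Matrix.fromBlocks T₁ 0 0 T₂)) ∈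
      adelicMpTheta F (ι₁ ⊕ ι₂) (Matrix.fromBlocks T₁ 0 0 T₂))
    (hp₂ : (s₂ (1, δ) : adelicMp F ι₂ T₂) ∈ adelicMpTheta F ι₂ T₂) :
    mpChar₂ s s₁ s₂ hs hT₁ hT₂ δ = 1 :=
  char₂_eq_one_of_thetaDistLM _ _ _ (exists_seesaw_scalar₃ s s₁ s₂ hs hT₁ hT₂)
    (fun Φ => thetaDistLM_omega_of_mem_adelicMpTheta hp Φ)
    (fun Φ => thetaDistLM_omega_of_mem_adelicMpTheta hp₂ Φ)

variable [TopologicalSpace GV] [TopologicalSpace U₁] [TopologicalSpace U₂]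

/-- Continuity of `λV` along continuous `s, s₁, s₂`. [folklore] -/
theorem continuous_mpCharV (hc : Continuous s) (hc₁ : Continuous s₁) (hc₂ : Continuous s₂) :
    Continuous fun g : GV => (mpCharV s s₁ s₂ hs hT₁ hT₂ g : ℂ) :=
  continuous_charV _ _ _ (exists_seesaw_scalar₃ s s₁ s₂ hs hT₁ hT₂)
    (fun Ψ x => (adelicMpCont.continuous_omega_apply Ψ x).comp hc)
    (fun Φ x => (adelicMpCont.continuous_omega_apply Φ x).comp hc₁)
    (fun Φ x => (adelicMpCont.continuous_omega_apply Φ x).comp hc₂)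

/-- Continuity of `λ₁`. [folklore] -/
theorem continuous_mpChar₁ (hc : Continuous s) (hc₁ : Continuous s₁) (hc₂ : Continuous s₂) :
    Continuous fun u : U₁ => (mpChar₁ s s₁ s₂ hs hT₁ hT₂ u : ℂ) :=
  continuous_char₁ _ _ _ (exists_seesaw_scalar₃ s s₁ s₂ hs hT₁ hT₂)
    (fun Ψ x => (adelicMpCont.continuous_omega_apply Ψ x).comp hc)
    (fun Φ x => (adelicMpCont.continuous_omega_apply Φ x).comp hc₁)
    (fun Φ x => (adelicMpCont.continuous_omega_apply Φ x).comp hc₂)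

/-- Continuity of `λ₂`. [folklore] -/
theorem continuous_mpChar₂ (hc : Continuous s) (hc₁ : Continuous s₁) (hc₂ : Continuous s₂) :
    Continuous fun u : U₂ => (mpChar₂ s s₁ s₂ hs hT₁ hT₂ u : ℂ) :=
  continuous_char₂ _ _ _ (exists_seesaw_scalar₃ s s₁ s₂ hs hT₁ hT₂)
    (fun Ψ x => (adelicMpCont.continuous_omega_apply Ψ x).comp hc)
    (fun Φ x => (adelicMpCont.continuous_omega_apply Φ x).comp hc₁)
    (fun Φ x => (adelicMpCont.continuous_omega_apply Φ x).comp hc₂)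

end Product

end Literature.NumberTheory.Weil1964

end

/-! ### Build-lane note (ops-buildfix G11b-3 recipe v2, LEDGER B13-1/B14-5/B14-7, 2026-08-22)
`lean -o` (the hub build lane, never `lean`/the gate check) runs Lean 4.32's library-suggestion indexers
(`Lean.LibrarySuggestions.SymbolFrequency` / `SineQuaNon`, from their `exportEntriesFn`) over the statement of every local
theorem constant that is not a denied premise; on this family's statements (very large dependent binder telescopes) that fold
runs for tens of minutes (incident G11b-3, run/shared/lean/ops/buildfix/G11b-3-DOSSIER.md). `isDeniedPremise` skips
`[implicit_reducible]` constants before any fold, and the status is inert on theorems (Meta never unfolds `thmInfo`).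
v2 form: ONE file-final, top-level `local` attribute — it goes through the synchronous scoped reducibility extension that
`getReducibilityStatusCore` reads first, so it needs no `set_option Elab.async false` (parallel elaboration stays on), also
reaches auto-realized `*.congr_simp` / structure-projection theorem constants, is never popped before export, and is not
exported. No statement or proof is changed. -/
set_option allowUnsafeReducibility true in
attribute [local implicit_reducible]
  Literature.NumberTheory.Weil1964.exists_seesaw_scalar
  Literature.NumberTheory.Weil1964.mpSeesawChar_spec
  Literature.NumberTheory.Weil1964.coe_mpSeesawChar_eq
  Literature.NumberTheory.Weil1964.thetaDistLM_omega_of_mem_adelicMpTheta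
  Literature.NumberTheory.Weil1964.mpSeesawChar_eq_one_of_mem_adelicMpTheta
  Literature.NumberTheory.Weil1964.twist_inv_mpSeesawChar_apply_tensorToSum
  Literature.NumberTheory.Weil1964.twist_inv_mpSeesawChar_eq_of_mem_adelicMpTheta
  Literature.NumberTheory.Weil1964.continuous_mpSeesawChar
  Literature.NumberTheory.Weil1964.exists_seesaw_scalar₃
  Literature.NumberTheory.Weil1964.mpSeesawChar₃_spec
  Literature.NumberTheory.Weil1964.mpSeesawChar₃_factor
  Literature.NumberTheory.Weil1964.mpCharSmall₁_apply_eq_mul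
  Literature.NumberTheory.Weil1964.mpCharSmall₂_apply
  Literature.NumberTheory.Weil1964.mpSeesaw_tensorToSum_twist_small
  Literature.NumberTheory.Weil1964.mpSeesaw_tensorToSum_twist_big
  Literature.NumberTheory.Weil1964.mpCharV_eq_one_of_mem_adelicMpTheta
  Literature.NumberTheory.Weil1964.mpChar₁_eq_one_of_mem_adelicMpTheta
  Literature.NumberTheory.Weil1964.mpChar₂_eq_one_of_mem_adelicMpTheta
  Literature.NumberTheory.Weil1964.continuous_mpCharV
  Literature.NumberTheory.Weil1964.continuous_mpChar₁
  Literature.NumberTheory.Weil1964.continuous_mpChar₂
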